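import Mathlib
import HarnessLib

/-!
# Route `IntegerScrew` — Thomson's principle (flow form of Cauchy–Schwarz) on a finite weighted graph

The bridge between the kernel's martingale (`IntegerScrewMartingale.variance_le_of_atom_room_le`, whose hypothesis
is «each atom's ROOM term ≤ s_p × the atom's Dirichlet form») and the WINDOW RESISTANCES of CONTINUUM-LIMIT §24.4:
a linear functional `G ↦ Σ_i ρ_i G_i` (`Σ ρ = 0`) realised as the divergence of a flow `J` on the edges is bounded
by `√(Σ_e J_e²/c_e) · √(Σ_e c_e (G_{e₁} − G_{e₂})²)` — so every explicit flow from a window to the bulk of an atom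
gives an explicit constant in the window law.

* `sum_mul_eq_sum_flow_mul_sub` — summation by parts: `Σ_i ρ_i G_i = Σ_e J_e (G e.1 − G e.2)` when `ρ = div J`;
* **`thomson_sq_le`** — `(Σ_i ρ_i G_i)² ≤ (Σ_e J_e²/c_e) · (Σ_e c_e (G e.1 − G e.2)²)` for conductances `c_e > 0`.

Generic (any finite vertex/edge sets); RH-free.

References: CONTINUUM-LIMIT §24.4 (rh-explicit A6-PIVOT); M. Suzuki, J. Lond. Math. Soc. (2) 108 (2023) 1448–1487
[Suzuki2023].
-/

noncomputable section

set_option linter.dupNamespace false -- D-0017: `Summit.<S>.<S>.…` is the designed namespace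

namespace Summit.RiemannHypothesis.RiemannHypothesis.Theorems.IntegerScrew

open Finset

/-- **Summation by parts along a flow.**  If `ρ i = (flow out of i) − (flow into i)` for every vertex of `V` and all
edges of `E` join vertices of `V`, then `Σ_{i∈V} ρ i · G i = Σ_{e∈E} J e · (G e.1 − G e.2)`. -/
theorem sum_mul_eq_sum_flow_mul_sub {ι : Type*} [DecidableEq ι] (V : Finset ι) (E : Finset (ι × ι))
    (J : ι × ι → ℝ) (ρ G : ι → ℝ) (hE : ∀ e ∈ E, e.1 ∈ V ∧ e.2 ∈ V)
    (hdiv : ∀ i ∈ V, ρ i = ∑ e ∈ E with e.1 = i, J e - ∑ e ∈ E with e.2 = i, J e) :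
    ∑ i ∈ V, ρ i * G i = ∑ e ∈ E, J e * (G e.1 - G e.2) := by
  have hout : ∑ i ∈ V, (∑ e ∈ E with e.1 = i, J e) * G i = ∑ e ∈ E, J e * G e.1 := by
    rw [← Finset.sum_fiberwise_of_maps_to (s := E) (t := V) (g := fun e => e.1) (fun e he => (hE e he).1)]
    refine Finset.sum_congr rfl fun i _ => ?_
    rw [Finset.sum_mul]
    refine Finset.sum_congr rfl fun e he => ?_
    rw [(mem_filter.1 he).2]
  have hin : ∑ i ∈ V, (∑ e ∈ E with e.2 = i, J e) * G i = ∑ e ∈ E, J e * G e.2 := by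
    rw [← Finset.sum_fiberwise_of_maps_to (s := E) (t := V) (g := fun e => e.2) (fun e he => (hE e he).2)]
    refine Finset.sum_congr rfl fun i _ => ?_
    rw [Finset.sum_mul]
    refine Finset.sum_congr rfl fun e he => ?_
    rw [(mem_filter.1 he).2]
  calc ∑ i ∈ V, ρ i * G i
      = ∑ i ∈ V, ((∑ e ∈ E with e.1 = i, J e) * G i - (∑ e ∈ E with e.2 = i, J e) * G i) :=
        Finset.sum_congr rfl fun i hi => by rw [hdiv i hi]; ring
    _ = ∑ e ∈ E, J e * G e.1 - ∑ e ∈ E, J e * G e.2 := by rw [Finset.sum_sub_distrib, hout, hin]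
    _ = ∑ e ∈ E, J e * (G e.1 - G e.2) := by rw [← Finset.sum_sub_distrib]; exact Finset.sum_congr rfl fun e _ => by ring

/-- **Thomson's principle (one direction): a flow bounds the dual energy.**  With conductances `c e > 0` on the
edges, a flow `J` with divergence `ρ` on `V`, and any `G`:
`(Σ_{i∈V} ρ i · G i)² ≤ (Σ_{e∈E} (J e)²/c e) · (Σ_{e∈E} c e · (G e.1 − G e.2)²)`. -/
theorem thomson_sq_le {ι : Type*} [DecidableEq ι] (V : Finset ι) (E : Finset (ι × ι))
    (c J : ι × ι → ℝ) (hc : ∀ e ∈ E, 0 < c e) (ρ G : ι → ℝ) (hE : ∀ e ∈ E, e.1 ∈ V ∧ e.2 ∈ V)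
    (hdiv : ∀ i ∈ V, ρ i = ∑ e ∈ E with e.1 = i, J e - ∑ e ∈ E with e.2 = i, J e) :
    (∑ i ∈ V, ρ i * G i) ^ 2 ≤ (∑ e ∈ E, J e ^ 2 / c e) * ∑ e ∈ E, c e * (G e.1 - G e.2) ^ 2 := by
  rw [sum_mul_eq_sum_flow_mul_sub V E J ρ G hE hdiv]
  -- Cauchy–Schwarz with f = J/√c, g = √c·Δ
  have hcs := Finset.sum_mul_sq_le_sq_mul_sq E (fun e => J e / Real.sqrt (c e))
    (fun e => Real.sqrt (c e) * (G e.1 - G e.2))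
  have h1 : ∀ e ∈ E, (J e / Real.sqrt (c e)) * (Real.sqrt (c e) * (G e.1 - G e.2)) = J e * (G e.1 - G e.2) := by
    intro e he
    have hs : Real.sqrt (c e) ≠ 0 := (Real.sqrt_pos.2 (hc e he)).ne'
    field_simp
  have h2 : ∀ e ∈ E, (J e / Real.sqrt (c e)) ^ 2 = J e ^ 2 / c e := by
    intro e he
    rw [div_pow, Real.sq_sqrt (hc e he).le]
  have h3 : ∀ e ∈ E, (Real.sqrt (c e) * (G e.1 - G e.2)) ^ 2 = c e * (G e.1 - G e.2) ^ 2 := by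
    intro e he
    rw [mul_pow, Real.sq_sqrt (hc e he).le]
  rw [Finset.sum_congr rfl h1, Finset.sum_congr rfl h2, Finset.sum_congr rfl h3] at hcs
  exact hcs

end Summit.RiemannHypothesis.RiemannHypothesis.Theorems.IntegerScrew

end
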